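import Literature.AlgebraicGeometry.Frobenioids.BaseCategoryTheoreticityDefs
import Literature.AlgebraicGeometry.Frobenioids.BaseIdentityPreStepsProofs
import HarnessLib

/-!
# Frobenioids I, Proposition 3.3 (i), converse direction AS TYPED (homomorphism form) — PROOF

Mochizuki, *The geometry of Frobenioids I: the general theory*, Kyushu J. Math. **62** (2008),
kurims text pp. 59–61 [cite: MochizukiFrdI2008, Prop. 3.3 (i) pp.59-61]. Proof-only companion of
`BaseCategoryTheoreticityDefs.lean` (seat abc-iut-L1-t3; the homomorphism form of `Prop33i_forward` /
`Prop33i_converse` over the componentwise monoid `End(C^pl-bk_A → C)^bs-iso`), abc-iut node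
`FrdI:Prop3.3(i)`:

* `prop33i_converse_holds S A : Prop33i_converse S A` — for every `S` and `A`: the component data
  `(Γ, Δ_d)` of `prop33i_converse_core` (`BaseIdentityPreStepsProofs.lean`) assemble, by the structure of
  `𝔽 = ℤ_{≥0} ⋊ N_{≥1}` (`StandardFrobenioid.exists_hom`), into a homomorphism `f : 𝔽 → End(C^pl-bk_A → C)^bs-iso`
  with `f(γ)_{id_A} = α`.
* `hom_component_relations` — conversely, a homomorphism `f` yields the component relations
  `Δ_d Γ = Γ^d Δ_d`, `Δ_1 = 1`, `Δ_{de} = Δ_d Δ_e` for `Γ = f(γ)`, `Δ_d = f((0,d))` (used by the forward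
  direction, `BaseIdentityPreStepsSlim.lean`).
No new definitions.
-/

namespace Literature.AlgebraicGeometry.Frobenioids

open CategoryTheory

universe w v v' u u'

variable {C : Type u} [Category.{v} C] {D : Type u'} [Category.{v'} D]
variable (S : PreFrobenioidData.{w} C D)

namespace PreFrobenioidData

/-- Components of a power in the monoid `End(C^pl-bk_A → C)^bs-iso` (componentwise).
[cite: MochizukiFrdI2008, Prop. 3.3 (i) p.59] -/
@[simp] theorem EndPlbkBsIso.pow_app {A : C} (N : S.EndPlbkBsIso A) (n : ℕ) ⦃B : C⦄ (φ : B ⟶ A)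
    (hφ : S.IsPullbackMorphism φ) : (N ^ n).app φ hφ = N.app φ hφ ^ n := by
  induction n with
  | zero => rfl
  | succ n ih => rw [pow_succ, pow_succ, EndPlbkBsIso.mul_app, ih]

/-- **Prop. 3.3 (i)**, converse direction [FrdI p. 59, proof pp. 60–61], AS TYPED (`Prop33i_converse`, the
homomorphism form), for every `S` and `A`: discharges this half of node `FrdI:Prop3.3(i)`.
[cite: MochizukiFrdI2008, Prop. 3.3 (i) p.59] -/
theorem prop33i_converse_holds (A : C) : Prop33i_converse S A := by
  intro hFN hFT hA α hα
  obtain ⟨Γ, Δ, hrel, h1, hmul, hid⟩ := S.prop33i_converse_core hFN hFT hA α hα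
  let Λ : ℕ+ →* S.EndPlbkBsIso A :=
    { toFun := Δ
      map_one' := EndPlbkBsIso.ext' fun B φ hφ => h1 φ hφ
      map_mul' := fun d e => EndPlbkBsIso.ext' fun B φ hφ => hmul d e φ hφ }
  obtain ⟨f, hf, -⟩ := StandardFrobenioid.exists_hom Γ Λ fun n =>
    EndPlbkBsIso.ext' fun B φ hφ => by
      rw [EndPlbkBsIso.mul_app, EndPlbkBsIso.mul_app, EndPlbkBsIso.pow_app]
      exact hrel n φ hφ
  exact ⟨f, by rw [hf]; exact hid⟩

/-- A homomorphism `f : 𝔽 → End(C^pl-bk_A → C)^bs-iso` yields, for `Γ := f(γ)` and `Δ_d := f((0,d))`, the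
componentwise relations `Δ_d Γ = Γ^d Δ_d` (from `δ_d γ = γ^d δ_d` in `𝔽`), `Δ_1 = 1` and
`Δ_{de} = Δ_d Δ_e`. [cite: MochizukiFrdI2008, Prop. 3.3 (i) p.59] -/
theorem hom_component_relations {A : C} (f : StandardFrobenioid →* S.EndPlbkBsIso A) :
    (∀ (d : ℕ+) ⦃B : C⦄ (φ : B ⟶ A) (hφ : S.IsPullbackMorphism φ),
        (f (StandardFrobenioid.degSection d)).app φ hφ * (f StandardFrobenioid.gen).app φ hφ =
          (f StandardFrobenioid.gen).app φ hφ ^ (d : ℕ) * (f (StandardFrobenioid.degSection d)).app φ hφ) ∧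
      (∀ ⦃B : C⦄ (φ : B ⟶ A) (hφ : S.IsPullbackMorphism φ),
        (f (StandardFrobenioid.degSection 1)).app φ hφ = 1) ∧
      ∀ (d e : ℕ+) ⦃B : C⦄ (φ : B ⟶ A) (hφ : S.IsPullbackMorphism φ),
        (f (StandardFrobenioid.degSection (d * e))).app φ hφ =
          (f (StandardFrobenioid.degSection d)).app φ hφ * (f (StandardFrobenioid.degSection e)).app φ hφ := by
  refine ⟨fun d B φ hφ => ?_, fun B φ hφ => ?_, fun d e B φ hφ => ?_⟩
  · rw [← EndPlbkBsIso.mul_app, ← EndPlbkBsIso.pow_app, ← EndPlbkBsIso.mul_app, ← map_pow, ← map_mul,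
      ← map_mul, StandardFrobenioid.degSection_mul_gen]
  · rw [map_one, map_one, EndPlbkBsIso.one_app]
  · rw [map_mul, map_mul, EndPlbkBsIso.mul_app]

end PreFrobenioidData

end Literature.AlgebraicGeometry.Frobenioids
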